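import Summits.BirchSwinnertonDyer.BirchSwinnertonDyer.Theorems.CycTangentCMCycTangentBoundPowerCharacters
import HarnessLib

set_option linter.dupNamespace false
set_option autoImplicit false

/-!
# Crux `CycTangentCM.CycTangentBound` (stmt-BirchSwinnertonDyer-22628), stub `stub_selfDual`:
# THE SIGN LEMMA — in a self-dual functional equation the constant is `±1` (de Shalit II.6.5 (18), DERIVED)

Seat `bsd-line-ctcm-p2` (line `tangent-cone-parity`, lead `bsd-line-ctcm-p1`). de Shalit's typed
functional equation `DeShalit1987.thmII64_katzMeasure₂_functionalEquation` delivers, for a frame `G`,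
a reflected frame `Ǧ`, a constant `C` and `g ∈ Γ_K` with `G(P r) = C·r(g)·Ǧ(P r₂)` for all
conjugate-inverse pairs `(r, r₂)` through the generator pair (`P r = (r(γ₁)−1, r(γ₂)−1)`). On a
SELF-DUAL branch (`Ǧ = G`, the uniqueness step) the registered stub `stub_selfDual` wants the constant
to be a SIGN `w ∈ {1, −1}` (II.6.5 (18) "`sgn(ε) = ±1`"). This file proves that this is AUTOMATIC:

* `sq_eq_one_of_selfRelation` — if `G ≠ 0` satisfies the self-relation `G(P r) = C·r(g)·G(P r₂)` for
  all conjugate-inverse pairs through a generator pair (`K` imaginary quadratic), then `C² = 1`.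
  PROOF: apply the relation to `(r, r₂)` and to `(r₂, r)` (`IsConjInverse` is symmetric):
  `G(P r) = C² r(g) r₂(g) G(P r)`; the characters `r = χ₁^a χ₂^b` (`χ_i(σ) = γ_cyc^{κ_i(σ)}`, the
  power characters through `κ₁`, `κ₂`, §1) with `pᵏ ∣ a, b` sweep a product of two infinite sets in
  the polydisc of radius `‖γ_cyc^{pᵏ} − 1‖`, on which `G ≠ 0` cannot vanish identically (identity
  principle `IntSeries.eq_zero_of_infinite_zeros₂`, p580670); so `C² = (r_k(g) r_{k,2}(g))⁻¹` for a
  sequence with `r_k(g) r_{k,2}(g) → 1`, whence `C² = 1`. The conjugate-inverse partner of `e∘χ` is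
  `e∘(χ∘θ_c)⁻¹`, `θ_c` the outer action of a complex conjugation (`absGaloisOuterConj`, §2).
* `exists_sign_of_selfRelation` — the (SD)-shaped packaging: from the self-relation with SOME constant
  `C` one gets it with a sign `w ∈ {1, −1}` (if `G = 0` trivially, else `C = ±1`).

THEOREMS ONLY (no `def`, no fact, no `sorry`); supports, does not close, stmt-BirchSwinnertonDyer-22628.
BSD is not proved by this.

References: [deShalit1987] II.6.4 (9), (14)–(15), II.6.5 (18); [Serre1973] Ch. II §3.2 Prop. 8
(`x ↦ (1+q)^x`); [Gouvea1993PadicNumbers] §5.6 (Strassmann).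
-/

noncomputable section

open scoped Topology
open Filter NumberField IsDedekindDomain Field
open Literature.NumberTheory.GaloisRepresentations Literature.NumberTheory.EllipticCurves
open Literature.NumberTheory.EllipticCurves.CyclotomicZp
open Summit.BirchSwinnertonDyer.Rank1Residual.X11b.Three.LambdaSupply
open Summit.BirchSwinnertonDyer.Rank1Residual.X11b.LambdaSupply
open Summit.BirchSwinnertonDyer.BirchSwinnertonDyer.Theorems.CycTangentCMCycTangentBoundPowerCharacters

namespace Summit.BirchSwinnertonDyer.BirchSwinnertonDyer.Theorems.CycTangentCMCycTangentBoundSignLemma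

variable {K : Type} [Field K] [NumberField K] {p : ℕ} [Fact p.Prime]

/-! ### The sign lemma -/

/-- **THE SIGN LEMMA.** Let `K` be imaginary quadratic, `(κ₁, κ₂; γ₁, γ₂)` a generator pair of
`ℤ_p`-quotients of `Γ_K`, and `G ∈ 𝒪_{ℂ_p}⟦T₁⟧⟦T₂⟧`, `G ≠ 0`, satisfying the SELF-dual relation: for
all conjugate-inverse pairs `(r, r₂)` through the pair, `G(P r) = C·r(g)·G(P r₂)`
(`P r = (r(γ₁) − 1, r(γ₂) − 1)`, values as `IntSeries.HasValueAt₂`). Then `C² = 1`. See the module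
docstring for the proof. [cite: deShalit1987, II.6.4 (14)–(15) (store chunk 85) and II.6.5 (18) (store chunk 86)]
[cite: Serre1973, Ch. II §3.2 Prop. 8] -/
theorem sq_eq_one_of_selfRelation (hK : IsImaginaryQuadratic K)
    {κ₁ κ₂ : ZpExtension K p} {γ₁ γ₂ : absoluteGaloisGroup K}
    (hpair : ZpExtension.IsTopGeneratorPair κ₁ κ₂ γ₁ γ₂)
    {G : PowerSeries (PowerSeries (PadicComplexInt p))} (hG : G ≠ 0) {C : ℂ_[p]}
    {g : absoluteGaloisGroup K}
    (hrel : ∀ (r r₂ : FramedGaloisRep K (PadicAlgCl p) 1),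
      FactorsThroughPair κ₁ κ₂ r → FactorsThroughPair κ₁ κ₂ r₂ → IsConjInverse r r₂ →
      ∀ x : ℂ_[p],
        IntSeries.HasValueAt₂ G (avatarValueAt r₂ γ₁ - 1) (avatarValueAt r₂ γ₂ - 1) x →
        IntSeries.HasValueAt₂ G (avatarValueAt r γ₁ - 1) (avatarValueAt r γ₂ - 1)
          (C * avatarValueAt r g * x)) :
    C ^ 2 = 1 := by
  classical
  haveI : Algebra.IsQuadraticExtension ℚ K := ⟨hK.1⟩
  have himag : ∀ w : InfinitePlace K, w.IsComplex := fun w ↦ hK.2.isComplex w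
  -- notation for the values `γ_cyc^z ∈ ℂ_p`, through the ring map `ℤ_p → ℚ_p → ℚ̄_p → ℂ_p`
  set Uhom : ℤ_[p] →+* ℂ_[p] :=
    ((UniformSpace.Completion.coeRingHom : PadicAlgCl p →+* ℂ_[p]).comp
      (algebraMap ℚ_[p] (PadicAlgCl p))).comp PadicInt.Coe.ringHom with hUhom_def
  have hUhom : ∀ x : ℤ_[p], Uhom x = (((x : ℤ_[p]) : ℚ_[p]) : ℂ_[p]) := fun _ ↦ rfl
  set U : ℤ_[p] → ℂ_[p] := fun z ↦ Uhom (cycPow p z) with hU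
  have hUmul : ∀ a b, U (a + b) = U a * U b := fun a b ↦ by
    simp only [hU, AddChar.map_add_eq_mul, map_mul]
  have hUneg : ∀ a, U (-a) * U a = 1 := fun a ↦ by
    simp only [hU, hUhom]; exact coe_cycPow_neg_mul a
  have hUnat : ∀ (n : ℕ) (a : ℤ_[p]), U ((n : ℤ_[p]) * a) = U a ^ n := fun n a ↦ by
    simp only [hU, ← nsmul_eq_mul, AddChar.map_nsmul_eq_pow, map_pow]
  have hU1 : ∀ z, ‖U z - 1‖ < 1 := fun z ↦ by
    simp only [hU, hUhom]; exact norm_coe_cycPow_sub_one_lt z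
  have hUsub : ∀ z, ‖U z - 1‖ = ‖z‖ * ‖((p : ℤ_[p]) ^ cyclotomicExponent p)‖ := fun z ↦ by
    simp only [hU, hUhom]; exact norm_coe_cycPow_sub_one z
  have hUcont : Continuous U := by
    simp only [hU]
    exact continuous_coe_cycPow
  -- a complex conjugation and its outer action
  haveI : IsGalois ℚ K := inferInstance
  obtain ⟨c, hc, -⟩ := exists_not_mem_range_absGaloisRestrict (K := ℚ) (L := K) (Rat.castHom ℝ) himag
  set θ := absGaloisOuterConj ℚ K c with hθ
  -- the power characters through `κ₁`, `κ₂`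
  obtain ⟨χ₁, hχ₁ker, hχ₁val⟩ := exists_powChar (p := p) κ₁
  obtain ⟨χ₂, hχ₂ker, hχ₂val⟩ := exists_powChar (p := p) κ₂
  -- coordinates of the generators
  have e11 : Multiplicative.toAdd (κ₁ γ₁) = 1 := by rw [hpair.left]; rfl
  have e21 : Multiplicative.toAdd (κ₂ γ₁) = 0 := by rw [hpair.apply_left]; rfl
  have e12 : Multiplicative.toAdd (κ₁ γ₂) = 0 := by rw [hpair.apply_right]; rfl
  have e22 : Multiplicative.toAdd (κ₂ γ₂) = 1 := by rw [hpair.right]; rfl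
  -- the characters `χ_{a,b} = χ₁^a χ₂^b`, their values and partners
  set χ : ℕ → ℕ → (absoluteGaloisGroup K →ₜ* (PadicAlgCl p)ˣ) := fun a b ↦ χ₁ ^ a * χ₂ ^ b with hχdef
  have hχval : ∀ a b σ, avatarValueAt ((FramedRep.unitsContinuousMulEquivOfUnique (Fin 1) (PadicAlgCl p) : (PadicAlgCl p)ˣ →ₜ* GL (Fin 1) (PadicAlgCl p)).comp (χ a b)) σ =
      U ((a : ℤ_[p]) * Multiplicative.toAdd (κ₁ σ) + (b : ℤ_[p]) * Multiplicative.toAdd (κ₂ σ)) := by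
    intro a b σ
    rw [hχdef, avatarValueAt_unitsChar_mul, avatarValueAt_unitsChar_pow, avatarValueAt_unitsChar_pow,
      avatarValueAt_unitsChar, avatarValueAt_unitsChar, hχ₁val, hχ₂val, hUmul, hUnat, hUnat, ← hUhom, ← hUhom]
  have hχpair : ∀ a b, FactorsThroughPair κ₁ κ₂ ((FramedRep.unitsContinuousMulEquivOfUnique (Fin 1) (PadicAlgCl p) : (PadicAlgCl p)ˣ →ₜ* GL (Fin 1) (PadicAlgCl p)).comp (χ a b)) := by
    intro a b σ h₁ h₂
    rw [ContinuousMonoidHom.coe_comp, Function.comp_apply, hχdef, ContinuousMonoidHom.mul_apply,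
      ContinuousMonoidHom.pow_apply, ContinuousMonoidHom.pow_apply, hχ₁ker σ h₁, hχ₂ker σ h₂, one_pow,
      one_pow, mul_one, map_one]
  set χ' : ℕ → ℕ → (absoluteGaloisGroup K →ₜ* (PadicAlgCl p)ˣ) := fun a b ↦ ((χ a b).comp θ)⁻¹ with hχ'def
  have hχ'val : ∀ a b σ, avatarValueAt ((FramedRep.unitsContinuousMulEquivOfUnique (Fin 1) (PadicAlgCl p) : (PadicAlgCl p)ˣ →ₜ* GL (Fin 1) (PadicAlgCl p)).comp (χ' a b)) σ =
      U (-((a : ℤ_[p]) * Multiplicative.toAdd (κ₁ (θ σ)) + (b : ℤ_[p]) * Multiplicative.toAdd (κ₂ (θ σ)))) := by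
    intro a b σ
    have h1 : avatarValueAt ((FramedRep.unitsContinuousMulEquivOfUnique (Fin 1) (PadicAlgCl p) : (PadicAlgCl p)ˣ →ₜ* GL (Fin 1) (PadicAlgCl p)).comp (χ' a b)) σ * avatarValueAt ((FramedRep.unitsContinuousMulEquivOfUnique (Fin 1) (PadicAlgCl p) : (PadicAlgCl p)ˣ →ₜ* GL (Fin 1) (PadicAlgCl p)).comp (χ a b)) (θ σ) = 1 := by
      rw [avatarValueAt_unitsChar, avatarValueAt_unitsChar, hχ'def]
      simp only [unitsChar_inv_apply, ContinuousMonoidHom.coe_comp, Function.comp_apply]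
      rw [← UniformSpace.Completion.coe_mul, ← Units.val_mul, inv_mul_cancel, Units.val_one,
        UniformSpace.Completion.coe_one]
    have h2 := hUneg ((a : ℤ_[p]) * Multiplicative.toAdd (κ₁ (θ σ)) + (b : ℤ_[p]) * Multiplicative.toAdd (κ₂ (θ σ)))
    rw [← hχval a b (θ σ)] at h2
    exact (eq_inv_of_mul_eq_one_left h1).trans (eq_inv_of_mul_eq_one_left h2).symm
  have hχ'pair : ∀ a b, FactorsThroughPair κ₁ κ₂ ((FramedRep.unitsContinuousMulEquivOfUnique (Fin 1) (PadicAlgCl p) : (PadicAlgCl p)ˣ →ₜ* GL (Fin 1) (PadicAlgCl p)).comp (χ' a b)) := fun a b ↦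
    factorsThroughPair_comp_outerConj_inv hK hpair c (hχpair a b)
  have hconj : ∀ a b, IsConjInverse ((FramedRep.unitsContinuousMulEquivOfUnique (Fin 1) (PadicAlgCl p) : (PadicAlgCl p)ˣ →ₜ* GL (Fin 1) (PadicAlgCl p)).comp (χ a b)) ((FramedRep.unitsContinuousMulEquivOfUnique (Fin 1) (PadicAlgCl p) : (PadicAlgCl p)ˣ →ₜ* GL (Fin 1) (PadicAlgCl p)).comp (χ' a b)) := fun a b ↦
    isConjInverse_comp_outerConj_inv hK.1 hc (χ a b)
  -- points of the characters
  have hP1 : ∀ a b, avatarValueAt ((FramedRep.unitsContinuousMulEquivOfUnique (Fin 1) (PadicAlgCl p) : (PadicAlgCl p)ˣ →ₜ* GL (Fin 1) (PadicAlgCl p)).comp (χ a b)) γ₁ - 1 = U (a : ℤ_[p]) - 1 := fun a b ↦ by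
    rw [hχval, e11, e21, mul_one, mul_zero, add_zero]
  have hP2 : ∀ a b, avatarValueAt ((FramedRep.unitsContinuousMulEquivOfUnique (Fin 1) (PadicAlgCl p) : (PadicAlgCl p)ˣ →ₜ* GL (Fin 1) (PadicAlgCl p)).comp (χ a b)) γ₂ - 1 = U (b : ℤ_[p]) - 1 := fun a b ↦ by
    rw [hχval, e12, e22, mul_one, mul_zero, zero_add]
  -- KEY: `C² · (r(g) r'(g)) = 1` whenever `G(P r) ≠ 0`
  have key : ∀ a b : ℕ, (∃ v, v ≠ 0 ∧ IntSeries.HasValueAt₂ G (U (a : ℤ_[p]) - 1) (U (b : ℤ_[p]) - 1) v) →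
      C ^ 2 * (avatarValueAt ((FramedRep.unitsContinuousMulEquivOfUnique (Fin 1) (PadicAlgCl p) : (PadicAlgCl p)ˣ →ₜ* GL (Fin 1) (PadicAlgCl p)).comp (χ a b)) g * avatarValueAt ((FramedRep.unitsContinuousMulEquivOfUnique (Fin 1) (PadicAlgCl p) : (PadicAlgCl p)ˣ →ₜ* GL (Fin 1) (PadicAlgCl p)).comp (χ' a b)) g) = 1 := by
    rintro a b ⟨v, hv0, hv⟩
    rw [← hP1 a b, ← hP2 a b] at hv
    -- a value at the partner's point
    have hx' : ‖avatarValueAt ((FramedRep.unitsContinuousMulEquivOfUnique (Fin 1) (PadicAlgCl p) : (PadicAlgCl p)ˣ →ₜ* GL (Fin 1) (PadicAlgCl p)).comp (χ' a b)) γ₁ - 1‖ < 1 := by rw [hχ'val]; exact hU1 _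
    have hy' : ‖avatarValueAt ((FramedRep.unitsContinuousMulEquivOfUnique (Fin 1) (PadicAlgCl p) : (PadicAlgCl p)ˣ →ₜ* GL (Fin 1) (PadicAlgCl p)).comp (χ' a b)) γ₂ - 1‖ < 1 := by rw [hχ'val]; exact hU1 _
    obtain ⟨v', hv'⟩ := exists_hasValueAt₂ G hx' hy'
    have h1 := hrel _ _ (hχpair a b) (hχ'pair a b) (hconj a b) v' hv'
    have h2 := hrel _ _ (hχ'pair a b) (hχpair a b) (isConjInverse_symm (hconj a b)) v hv
    have e1 : v = C * avatarValueAt ((FramedRep.unitsContinuousMulEquivOfUnique (Fin 1) (PadicAlgCl p) : (PadicAlgCl p)ˣ →ₜ* GL (Fin 1) (PadicAlgCl p)).comp (χ a b)) g * v' := hv.unique h1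
    have e2 : v' = C * avatarValueAt ((FramedRep.unitsContinuousMulEquivOfUnique (Fin 1) (PadicAlgCl p) : (PadicAlgCl p)ˣ →ₜ* GL (Fin 1) (PadicAlgCl p)).comp (χ' a b)) g * v := hv'.unique h2
    have e3 : v * (C ^ 2 * (avatarValueAt ((FramedRep.unitsContinuousMulEquivOfUnique (Fin 1) (PadicAlgCl p) : (PadicAlgCl p)ˣ →ₜ* GL (Fin 1) (PadicAlgCl p)).comp (χ a b)) g * avatarValueAt ((FramedRep.unitsContinuousMulEquivOfUnique (Fin 1) (PadicAlgCl p) : (PadicAlgCl p)ˣ →ₜ* GL (Fin 1) (PadicAlgCl p)).comp (χ' a b)) g) - 1) = 0 := by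
      have : v = C ^ 2 * (avatarValueAt ((FramedRep.unitsContinuousMulEquivOfUnique (Fin 1) (PadicAlgCl p) : (PadicAlgCl p)ˣ →ₜ* GL (Fin 1) (PadicAlgCl p)).comp (χ a b)) g * avatarValueAt ((FramedRep.unitsContinuousMulEquivOfUnique (Fin 1) (PadicAlgCl p) : (PadicAlgCl p)ˣ →ₜ* GL (Fin 1) (PadicAlgCl p)).comp (χ' a b)) g) * v := by
        conv_lhs => rw [e1, e2]
        ring
      linear_combination -this
    rcases mul_eq_zero.mp e3 with h | h
    · exact absurd h hv0
    · exact sub_eq_zero.mp h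
  -- nonvanishing points from the identity principle, at every level `k`
  have hq : ‖((p : ℤ_[p]) ^ cyclotomicExponent p)‖ < 1 := by
    rw [cyclotomicExponent_eq_succ]; exact PadicOneUnits.norm_p_pow_succ_lt_one p _
  have hq0 : ((p : ℤ_[p]) ^ cyclotomicExponent p) ≠ 0 := pow_ne_zero _ (NeZero.ne _)
  have hpk0 : ∀ k : ℕ, ((p : ℤ_[p]) ^ k) ≠ 0 := fun k ↦ pow_ne_zero _ (NeZero.ne _)
  have hlevel : ∀ k : ℕ, ∃ m n : ℕ, ∃ v : ℂ_[p], v ≠ 0 ∧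
      IntSeries.HasValueAt₂ G (U ((p ^ k * m : ℕ) : ℤ_[p]) - 1) (U ((p ^ k * n : ℕ) : ℤ_[p]) - 1) v := by
    intro k
    by_contra hcon
    push Not at hcon
    apply hG
    -- the radius
    set ϖ : ℂ_[p] := U ((p : ℤ_[p]) ^ k) - 1 with hϖ
    have hnormϖ : ‖ϖ‖ = ‖((p : ℤ_[p]) ^ k)‖ * ‖((p : ℤ_[p]) ^ cyclotomicExponent p)‖ := by
      rw [hϖ]; exact hUsub _
    have hϖ0 : ϖ ≠ 0 := by
      rw [← norm_pos_iff, hnormϖ]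
      exact mul_pos (norm_pos_iff.mpr (hpk0 k)) (norm_pos_iff.mpr hq0)
    have hϖ1 : ‖ϖ‖ < 1 := by
      rw [hnormϖ]
      exact mul_lt_one_of_nonneg_of_lt_one_right (PadicInt.norm_le_one _) (norm_nonneg _) hq
    -- the points `γ_cyc^{p^k m} - 1`
    have hpt_norm : ∀ m : ℕ, ‖U ((p ^ k * m : ℕ) : ℤ_[p]) - 1‖ ≤ ‖ϖ‖ := fun m ↦ by
      rw [hnormϖ, hUsub]
      refine mul_le_mul_of_nonneg_right ?_ (norm_nonneg _)
      push_cast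
      rw [norm_mul]
      exact mul_le_of_le_one_right (norm_nonneg _) (PadicInt.norm_le_one _)
    have hpt_le : ∀ m : ℕ, ‖U ((p ^ k * m : ℕ) : ℤ_[p]) - 1‖ ≤ 1 := fun m ↦ (hpt_norm m).trans hϖ1.le
    have hpt_inj : Function.Injective fun m : ℕ ↦ U ((p ^ k * m : ℕ) : ℤ_[p]) - 1 := by
      intro m m' h
      have h' : U ((p ^ k * m : ℕ) : ℤ_[p]) = U ((p ^ k * m' : ℕ) : ℤ_[p]) := sub_left_injective h
      have hUinj : Function.Injective Uhom :=
        ((UniformSpace.Completion.coe_injective (PadicAlgCl p)).comp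
          (algebraMap ℚ_[p] (PadicAlgCl p)).injective).comp Subtype.val_injective
      have h3 := cycPow_injective p (hUinj h')
      have h4 : (p ^ k * m : ℕ) = p ^ k * m' := by exact_mod_cast h3
      exact Nat.eq_of_mul_eq_mul_left (pow_pos (Fact.out : p.Prime).pos k) h4
    set D₁ : Set (PadicComplexInt p) :=
      Set.range fun m : ℕ ↦ (⟨U ((p ^ k * m : ℕ) : ℤ_[p]) - 1, mem_padicComplexInt_iff.mpr (hpt_le m)⟩ :
        PadicComplexInt p) with hD₁
    set D₂ : Set ℂ_[p] := Set.range fun n : ℕ ↦ U ((p ^ k * n : ℕ) : ℤ_[p]) - 1 with hD₂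
    have hD₁inf : D₁.Infinite := Set.infinite_range_of_injective fun m m' h ↦
      hpt_inj (congrArg (fun c : PadicComplexInt p ↦ (c : ℂ_[p])) h)
    have hD₂inf : D₂.Infinite := Set.infinite_range_of_injective hpt_inj
    refine IntSeries.eq_zero_of_infinite_zeros₂ hϖ0 hϖ1 hD₁inf ?_ hD₂inf ?_ ?_
    · rintro _ ⟨m, rfl⟩; exact hpt_norm m
    · rintro _ ⟨n, rfl⟩; exact hpt_norm n
    · rintro _ ⟨m, rfl⟩ _ ⟨n, rfl⟩
      change IntSeries.HasValueAt₂ G (U ((p ^ k * m : ℕ) : ℤ_[p]) - 1) (U ((p ^ k * n : ℕ) : ℤ_[p]) - 1) 0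
      obtain ⟨v, hv⟩ := exists_hasValueAt₂ G ((hpt_norm m).trans_lt hϖ1) ((hpt_norm n).trans_lt hϖ1)
      have := hcon m n v
      by_cases hv0 : v = 0
      · rwa [hv0] at hv
      · exact absurd hv (this hv0)
  -- choose the levels
  choose m n v hv0 hv using hlevel
  -- `C² = U(w_k)` with `w_k → 0`
  set z : ℕ → ℤ_[p] := fun k ↦
    ((p ^ k * m k : ℕ) : ℤ_[p]) * Multiplicative.toAdd (κ₁ g) + ((p ^ k * n k : ℕ) : ℤ_[p]) * Multiplicative.toAdd (κ₂ g)
    with hz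
  set z' : ℕ → ℤ_[p] := fun k ↦
    ((p ^ k * m k : ℕ) : ℤ_[p]) * Multiplicative.toAdd (κ₁ (θ g)) +
      ((p ^ k * n k : ℕ) : ℤ_[p]) * Multiplicative.toAdd (κ₂ (θ g)) with hz'
  have hCk : ∀ k, C ^ 2 = U (-(z k + -z' k)) := by
    intro k
    have h := key (p ^ k * m k) (p ^ k * n k) ⟨v k, hv0 k, hv k⟩
    rw [hχval, hχ'val, ← hUmul] at h
    -- `C² · U(z_k - z'_k) = 1`
    have h2 := hUneg (z k + -z' k)
    have hne : U (z k + -z' k) ≠ 0 := fun h0 ↦ by rw [h0, mul_zero] at h2; exact zero_ne_one h2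
    exact mul_right_cancel₀ hne (h.trans h2.symm)
  -- `z_k - z'_k → 0`
  have hsmall : ∀ k, ‖-(z k + -z' k)‖ ≤ ‖((p : ℤ_[p]) ^ k)‖ := by
    intro k
    have e1 : -(z k + -z' k) = (p : ℤ_[p]) ^ k *
        (((m k : ℕ) : ℤ_[p]) * (Multiplicative.toAdd (κ₁ (θ g)) - Multiplicative.toAdd (κ₁ g)) +
          ((n k : ℕ) : ℤ_[p]) * (Multiplicative.toAdd (κ₂ (θ g)) - Multiplicative.toAdd (κ₂ g))) := by
      simp only [hz, hz']; push_cast; ring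
    rw [e1, norm_mul]
    exact mul_le_of_le_one_right (norm_nonneg _) (PadicInt.norm_le_one _)
  have hp1 : ‖(p : ℤ_[p])‖ < 1 := by
    rw [PadicInt.norm_p]; exact inv_lt_one_of_one_lt₀ (by exact_mod_cast (Fact.out : p.Prime).one_lt)
  have htend0 : Tendsto (fun k ↦ -(z k + -z' k)) atTop (𝓝 0) := by
    refine squeeze_zero_norm hsmall ?_
    have := (tendsto_pow_atTop_nhds_zero_of_norm_lt_one hp1).norm
    rwa [norm_zero] at this
  have htend1 : Tendsto (fun k ↦ U (-(z k + -z' k))) atTop (𝓝 1) := by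
    have h := (hUcont.tendsto 0).comp htend0
    have hU0 : U 0 = 1 := by simp only [hU, AddChar.map_zero_eq_one, map_one]
    rwa [hU0] at h
  have hconst : (fun k ↦ U (-(z k + -z' k))) = fun _ ↦ C ^ 2 := funext fun k ↦ (hCk k).symm
  rw [hconst] at htend1
  exact tendsto_nhds_unique tendsto_const_nhds htend1

/-- **The self-dual functional equation carries a SIGN.** If `G` satisfies the self-relation
`G(P r) = C·r(g)·G(P r₂)` for all conjugate-inverse pairs through a generator pair (`K` imaginary
quadratic) with SOME constant `C ∈ ℂ_p`, then it satisfies it with a sign `w ∈ {1, −1}` in place of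
`C` — verbatim the conclusion shape of the registered stub `stub_selfDual` /
`DeShalit1987.thmII64_selfDual_functionalEquation_cm`. (If `G = 0` every `w` works; otherwise `C² = 1`
by `sq_eq_one_of_selfRelation`, so `C = ±1`.) This DERIVES de Shalit II.6.5 (18) "`sgn(ε) = ±1`" from
the shape of II.6.4 (9) on a self-dual branch. [cite: deShalit1987, II.6.5 (18) (store chunk 86) and II.6.4 (9) (store chunk 84)] -/
theorem exists_sign_of_selfRelation (hK : IsImaginaryQuadratic K)
    {κ₁ κ₂ : ZpExtension K p} {γ₁ γ₂ : absoluteGaloisGroup K}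
    (hpair : ZpExtension.IsTopGeneratorPair κ₁ κ₂ γ₁ γ₂)
    {G : PowerSeries (PowerSeries (PadicComplexInt p))} {C : ℂ_[p]} {g : absoluteGaloisGroup K}
    (hrel : ∀ (r r₂ : FramedGaloisRep K (PadicAlgCl p) 1),
      FactorsThroughPair κ₁ κ₂ r → FactorsThroughPair κ₁ κ₂ r₂ → IsConjInverse r r₂ →
      ∀ x : ℂ_[p],
        IntSeries.HasValueAt₂ G (avatarValueAt r₂ γ₁ - 1) (avatarValueAt r₂ γ₂ - 1) x →
        IntSeries.HasValueAt₂ G (avatarValueAt r γ₁ - 1) (avatarValueAt r γ₂ - 1)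
          (C * avatarValueAt r g * x)) :
    ∃ (w : ℤ) (g' : absoluteGaloisGroup K), (w = 1 ∨ w = -1) ∧
      ∀ (r r₂ : FramedGaloisRep K (PadicAlgCl p) 1),
        FactorsThroughPair κ₁ κ₂ r → FactorsThroughPair κ₁ κ₂ r₂ → IsConjInverse r r₂ →
        ∀ x : ℂ_[p],
          IntSeries.HasValueAt₂ G (avatarValueAt r₂ γ₁ - 1) (avatarValueAt r₂ γ₂ - 1) x →
          IntSeries.HasValueAt₂ G (avatarValueAt r γ₁ - 1) (avatarValueAt r γ₂ - 1)
            ((w : ℂ_[p]) * avatarValueAt r g' * x) := by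
  by_cases hG : G = 0
  · subst hG
    refine ⟨1, g, Or.inl rfl, fun r r₂ _ _ _ x hx ↦ ?_⟩
    rw [hasValueAt₂_zero_iff] at hx ⊢
    rw [hx, mul_zero]
  · have hC := sq_eq_one_of_selfRelation hK hpair hG hrel
    rw [sq, mul_self_eq_one_iff] at hC
    rcases hC with hC | hC
    · exact ⟨1, g, Or.inl rfl, fun r r₂ hr hr₂ hc x hx ↦ by
        simpa [hC] using hrel r r₂ hr hr₂ hc x hx⟩
    · exact ⟨-1, g, Or.inr rfl, fun r r₂ hr hr₂ hc x hx ↦ by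
        simpa [hC] using hrel r r₂ hr hr₂ hc x hx⟩

end Summit.BirchSwinnertonDyer.BirchSwinnertonDyer.Theorems.CycTangentCMCycTangentBoundSignLemma

end
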